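import Summits.ABC.IUTFork.Charitable.Thm311D1PerPlaceSeparationSub
import HarnessLib

/-!
# Branch D, team D1 — the sub-packet separation at EVERY Cor. 3.12 setting; attack (α): no single indeterminacy; tightness of the hypothesis

Record file (D-0012; abc-iut cell, rung LADDER-ABC:A2.D; abc-iut-D1-cx gen 2 = team D1's adversary, anchor ruling R3 2026-08-26T10:40:58Z (3);
proxy-filed by a D1 prover seat). TAKES NO SIDE on [IUTchIII] Cor. 3.12 or on any author; NO `Prop` fact, NO definition: a PROOF-ONLY
addendum to abc-iut-D1-prv's p438449 `Thm311D1PerPlaceSeparationSub` (`sepDatumSub`, `negSummandFamily`, `no_uniform_of_fix_and_neg` BY NAME).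
ADDED (p438449 fixes the setting `idSetting`): over ANY index skeleton with two distinct bad places `v ≠ v′`, sign shells, `NaiveProv.full1`:
(i) `T.over v′ = T.over v` ⟹ the PER-PLACE square holds for `sepDatumSub` at EVERY setting `P` (`sepDatumSub_perPlace_allP`) and the UNIFORM
square fails at EVERY `P` (`sepDatumSub_not_pilotKummerCompat_allP`): the square sees `P` only through the column `P.n`, whose Kummer image
is `Ψ` in every row (`NaiveProv.full1_frobΨ`);
(ii) attack (α) closed: NO SINGLE `Φ ∈ ⟨(Ind1)∪(Ind2)⟩` realises the datum place by place EVEN WITH PLACE-DEPENDENT ROWS `m_w`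
(`sepDatumSub_no_single_indeterminacy`) — the freedom the uniform square removes is the indeterminacy `Φ_w`, not the row; packaged
`perPlace_separation_sub_allP`; closed instance `perPlace_separation_sub_allP_instance` (`twoBadIndex`, `q = 2`): ONE lattice situation, ONE
sub-packet-placed q-datum, per-place true and uniform false for ALL settings at once;
(iii) TIGHTNESS (the adversary's `_false_without_` reading): «two bad places over ONE rational place» is exactly what the separation uses —
over pairwise DISTINCT rational places (`BadOverDistinct`, p431983) every bad-place-indexed family of (Ind2)-families patches to ONE
(Ind2)-family on ANY log-shell carrier ((Ind2) is local in `v_ℚ`; `ind2Family_patch_of_badOverDistinct`), so (Ind2)-realised per-place data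
satisfy the uniform square (`pilotKummerCompat_of_perPlace_ind2`), in particular the SAME datum `sepDatumSub p v v′` at every `P`
(`sepDatumSub_pilotKummerCompat_of_badOverDistinct`). DICHOTOMY for ONE datum shape: same rational place ⟹ uniform FAILS at all `P`;
`BadOverDistinct` ⟹ uniform HOLDS at all `P`.
Which reading print's final clause of (iii)(c) bears (p. 158 l. 6–15 over «for 𝕍^bad ∋ v» p. 155 l. 79–85) is the referee's call, not
answered here. HONEST SCOPE as in p438449 (sign shells; no pin is used here). Standard axioms; typed ≠ proved.
[claim: Mochizuki2012, status: disputed] [cite: ScholzeStix2018, §2.2 pp. 9–10]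
-/

noncomputable section

open Set

namespace Summit.ABC.IUTFork.Charitable

open Thm311 Cor312 Cor312Vol Literature.IUT.LogThetaLattice

variable {T : ThetaIndex} (p : ℕ)

/-- **(i) The per-place square holds at EVERY Cor. 3.12 setting `P`** over `NaiveProv.full1` (row `0`; the indeterminacy is
`negSummandFamily v′` at `v`, the identity elsewhere). [folklore] -/
theorem sepDatumSub_perPlace_allP (v v' : T.V) (c : ℝ)
    (P : Cor312.Setting (NaiveProv.situationOf p (T.over v) c (NaiveProv.thetaVec1 p))) :
    PerPlaceKummerCompat (NaiveProv.full1 p (T.over v) c).toLatticeSituation P (sepDatumSub p v v') := by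
  classical
  intro w hw
  refine ⟨if w = v then negSummandFamily v' else 1, ?_, 0, ?_⟩
  · split_ifs
    · exact negSummandFamily_mem_closure v'
    · exact one_mem _
  · rw [NaiveProv.full1_frobΨ p (T.over v) c P.n 0, sepDatumSub_eq]

variable [hp : Fact p.Prime]

/-- **(ii) Attack (α), closed: no SINGLE indeterminacy realises the datum place by place, whatever rows `m_w`**, at every setting `P`
(every row's Kummer image is `Ψ`; then `no_uniform_of_fix_and_neg`). [folklore] -/
theorem sepDatumSub_no_single_indeterminacy (c : ℝ) {v v' : T.V} (hv : v ∈ T.Vbad) (hv' : v' ∈ T.Vbad) (hne : v ≠ v')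
    (hover : T.over v' = T.over v) (P : Cor312.Setting (NaiveProv.situationOf p (T.over v) c (NaiveProv.thetaVec1 p))) :
    ¬ ∃ Φ ∈ Subgroup.closure ((NaiveProv.signShells T).Ind1Family ∪ (NaiveProv.signShells T).Ind2Family),
      ∀ (w : T.V) (hw : w ∈ T.Vbad), ∃ m : ℤ, sepDatumSub p v v' w hw =
        (NaiveProv.signShells T).starAut Φ w '' ((NaiveProv.full1 p (T.over v) c).col P.n).frobΨ m w hw := by
  classical
  rintro ⟨Φ, hΦ, hm⟩
  obtain ⟨m₁, hm₁⟩ := hm v' hv'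
  obtain ⟨m₂, hm₂⟩ := hm v hv
  rw [NaiveProv.full1_frobΨ p (T.over v) c P.n m₁] at hm₁
  rw [NaiveProv.full1_frobΨ p (T.over v) c P.n m₂] at hm₂
  have h1 : NaiveProv.PsiOf (NaiveProv.thetaVec1 p) v' =
      (NaiveProv.signShells T).starAut Φ v' '' NaiveProv.PsiOf (NaiveProv.thetaVec1 p) v' := by
    simpa [sepDatumSub, hne.symm] using hm₁
  have h2 : (NaiveProv.signShells T).starAut (negSummandFamily v') v '' NaiveProv.PsiOf (NaiveProv.thetaVec1 p) v =
      (NaiveProv.signShells T).starAut Φ v '' NaiveProv.PsiOf (NaiveProv.thetaVec1 p) v := by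
    simpa [sepDatumSub] using hm₂
  exact no_uniform_of_fix_and_neg p hΦ hne hover h1 h2

/-- **(i′) The UNIFORM square fails at EVERY Cor. 3.12 setting `P`** (p438449 states it at `idSetting`). [folklore] -/
theorem sepDatumSub_not_pilotKummerCompat_allP (c : ℝ) {v v' : T.V} (hv : v ∈ T.Vbad) (hv' : v' ∈ T.Vbad) (hne : v ≠ v')
    (hover : T.over v' = T.over v) (P : Cor312.Setting (NaiveProv.situationOf p (T.over v) c (NaiveProv.thetaVec1 p))) :
    ¬ PilotKummerCompat (NaiveProv.full1 p (T.over v) c).toLatticeSituation P (sepDatumSub p v v') :=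
  fun ⟨Φ, hΦ, m, hm⟩ =>
    sepDatumSub_no_single_indeterminacy p c hv hv' hne hover P ⟨Φ, hΦ, fun w hw => ⟨m, hm w hw⟩⟩

/-- **The separation, uniformly in the setting**: sub-packet placement, and FOR EVERY `P` the per-place square holds while neither the
uniform square nor any single indeterminacy with place-dependent rows realises the datum. [claim: Mochizuki2012, status: disputed] -/
theorem perPlace_separation_sub_allP (c : ℝ) {v v' : T.V} (hv : v ∈ T.Vbad) (hv' : v' ∈ T.Vbad) (hne : v ≠ v')
    (hover : T.over v' = T.over v) :
    (∀ (w : T.V) (hw : w ∈ T.Vbad), ∀ f ∈ sepDatumSub p v v' w hw, ∀ j : T.LabelStar,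
        f j ∈ (NaiveProv.signShells T).SubPacket j.1 w) ∧
    ∀ P : Cor312.Setting (NaiveProv.situationOf p (T.over v) c (NaiveProv.thetaVec1 p)),
      PerPlaceKummerCompat (NaiveProv.full1 p (T.over v) c).toLatticeSituation P (sepDatumSub p v v') ∧
      ¬ PilotKummerCompat (NaiveProv.full1 p (T.over v) c).toLatticeSituation P (sepDatumSub p v v') ∧
      ¬ ∃ Φ ∈ Subgroup.closure ((NaiveProv.signShells T).Ind1Family ∪ (NaiveProv.signShells T).Ind2Family),
        ∀ (w : T.V) (hw : w ∈ T.Vbad), ∃ m : ℤ, sepDatumSub p v v' w hw =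
          (NaiveProv.signShells T).starAut Φ w '' ((NaiveProv.full1 p (T.over v) c).col P.n).frobΨ m w hw :=
  ⟨fun w hw _ hf j => sepDatumSub_subPacket p v v' w hw hf j, fun P =>
    ⟨sepDatumSub_perPlace_allP p v v' c P, sepDatumSub_not_pilotKummerCompat_allP p c hv hv' hne hover P,
      sepDatumSub_no_single_indeterminacy p c hv hv' hne hover P⟩⟩

/-- **Closed (binder-free) form** at `twoBadIndex` (`q = 2`, `c = 1`): ONE lattice situation and ONE sub-packet-placed q-datum at which,
for EVERY Cor. 3.12 setting, the per-place square holds and the uniform square fails. [claim: Mochizuki2012, status: disputed] -/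
theorem perPlace_separation_sub_allP_instance :
    ∃ (T : ThetaIndex) (S : LatticeSituation T) (qK : ∀ v : T.V, v ∈ T.Vbad → Set (S.L.StarPacket v)),
      (∀ (w : T.V) (hw : w ∈ T.Vbad), ∀ f ∈ qK w hw, ∀ j : T.LabelStar, f j ∈ S.L.SubPacket j.1 w) ∧
      ∀ P : Cor312.Setting S.toSituation, PerPlaceKummerCompat S P qK ∧ ¬ PilotKummerCompat S P qK := by
  haveI : Fact (Nat.Prime 2) := ⟨Nat.prime_two⟩
  obtain ⟨hsub, hall⟩ := perPlace_separation_sub_allP (T := twoBadIndex) 2 1 (v := true) (v' := false) trivial trivial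
    (show (true : Bool) ≠ false by decide) rfl
  exact ⟨twoBadIndex, (NaiveProv.full1 2 (twoBadIndex.over true) 1).toLatticeSituation, sepDatumSub (T := twoBadIndex) 2 true false,
    hsub, fun P => ⟨(hall P).1, (hall P).2.1⟩⟩

/-! ## Tightness: over pairwise distinct rational places, (Ind2)-realised per-place data ARE uniform -/

/-- **(Ind2) patches over distinct rational places**, on ANY log-shell carrier: a bad-place-indexed family of (Ind2)-families is realised
star-packet-wise by ONE (Ind2)-family (over `v_ℚ(v)` the family chosen at the unique bad `v` there; the identity elsewhere). [folklore] -/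
theorem ind2Family_patch_of_badOverDistinct (S : LatticeSituation T) (hdist : BadOverDistinct T)
    (Φv : ∀ v : T.V, v ∈ T.Vbad → S.L.PacketAut) (hΦv : ∀ v hv, Φv v hv ∈ S.L.Ind2Family) :
    ∃ Φ ∈ S.L.Ind2Family, ∀ v hv, S.L.starAut Φ v = S.L.starAut (Φv v hv) v := by
  classical
  refine ⟨fun j vQ => if h : ∃ w, ∃ _ : w ∈ T.Vbad, T.over w = vQ then Φv h.choose h.choose_spec.1 j vQ
      else LinearEquiv.refl ℚ _, fun j vQ => ?_, fun v hv => ?_⟩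
  · by_cases h : ∃ w, ∃ _ : w ∈ T.Vbad, T.over w = vQ
    · simp only [dif_pos h]; exact hΦv _ _ j vQ
    · simp only [dif_neg h]; exact S.L.refl_mem_Ind2 j vQ
  · have h : ∃ w, ∃ _ : w ∈ T.Vbad, T.over w = T.over v := ⟨v, hv, rfl⟩
    have hw : h.choose = v := hdist h.choose_spec.1 hv h.choose_spec.2
    have key : ∀ (w : T.V) (hw' : w ∈ T.Vbad), w = v → ∀ (j : T.LabelStar) (y : S.L.Packet j.1 (T.over v)),
        Φv w hw' j.1 (T.over v) y = Φv v hv j.1 (T.over v) y := by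
      rintro w hw' rfl j y
      rfl
    ext x j
    rw [starAut_apply, starAut_apply, dif_pos h]
    exact key _ _ hw j (x j)

/-- **Hence: per-place data realised by (Ind2) indeterminacies satisfy the UNIFORM square when the bad places lie over pairwise distinct
rational places** ((ii)(b) absorbs the rows). [claim: Mochizuki2012, status: disputed] -/
theorem pilotKummerCompat_of_perPlace_ind2 (S : LatticeSituation T) (P : Cor312.Setting S.toSituation)
    (qK : ∀ v : T.V, v ∈ T.Vbad → Set (S.L.StarPacket v)) (hKumB : (S.col P.n).KummerB (S.D P.n))
    (hdist : BadOverDistinct T)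
    (hC : ∀ (v : T.V) (hv : v ∈ T.Vbad), ∃ Φ ∈ S.L.Ind2Family, ∃ m : ℤ,
      qK v hv = S.L.starAut Φ v '' (S.col P.n).frobΨ m v hv) :
    PilotKummerCompat S P qK := by
  classical
  choose Φv hΦv m hm using hC
  obtain ⟨Φ, hΦ, hagree⟩ := ind2Family_patch_of_badOverDistinct S hdist Φv hΦv
  refine ⟨Φ, Subgroup.subset_closure (Or.inr hΦ), 0, fun v hv => ?_⟩
  rw [hm v hv, hKumB (m v hv) v hv, hKumB 0 v hv, hagree v hv]

/-- **Tightness of the separation's hypothesis**: the SAME datum `sepDatumSub p v v′` SATISFIES the uniform square at every setting `P`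
as soon as the bad places lie over pairwise distinct rational places. [claim: Mochizuki2012, status: disputed] -/
theorem sepDatumSub_pilotKummerCompat_of_badOverDistinct (v v' : T.V) (c : ℝ) (hdist : BadOverDistinct T)
    (P : Cor312.Setting (NaiveProv.situationOf p (T.over v) c (NaiveProv.thetaVec1 p))) :
    PilotKummerCompat (NaiveProv.full1 p (T.over v) c).toLatticeSituation P (sepDatumSub p v v') := by
  classical
  refine pilotKummerCompat_of_perPlace_ind2 _ P _
    (GluedMonoids.kummerB_of_statement (NaiveProv.full1 p (T.over v) c) (NaiveProv.full1_statement p (T.over v) c) _) hdist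
    fun w hw => ⟨if w = v then negSummandFamily v' else 1, ?_, 0, ?_⟩
  · by_cases hwv : w = v
    · rw [if_pos hwv]; exact negSummandFamily_mem_Ind2Family v'
    · rw [if_neg hwv]; exact fun j vQ => (NaiveProv.signShells T).refl_mem_Ind2 j vQ
  · rw [NaiveProv.full1_frobΨ p (T.over v) c P.n 0, sepDatumSub_eq]

end Summit.ABC.IUTFork.Charitable

end
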